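import Summits.BirchSwinnertonDyer.BirchSwinnertonDyer.Theorems.ByReductionTypeAtTwoOrdKatoHalfAtTwoIsoConjATwoOfPointFieldMu
import Literature.NumberTheory.IwasawaTheory.ClassicalMuInvariantOnePrimeProofs
import HarnessLib

/-!
# Route `ByReductionTypeAtTwo` (K4), additive (A)₂ cruxes C1″ 22615 / C3″ 22617: THE SEXTIC FIELD DOOR — statement (A) at `(W, 2)`
# from «odd class number + ONE prime above `2`» of the carrier `ℚ(P, √−1)`, KERNEL, with NO Lim fact
# (a `--supports 22615` file; seat `bsd-2adic-k4-w2` GEN 9; «GENUS-BRIDGE» step 3: the curve side)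

HONEST FRAMING (cell `bsd-2adic`, D-0036/D-0054): THEOREMS ONLY (no definition, no named fact, no `sorry`); PROVED OUTRIGHT for
every elliptic curve over a number field, CONDITIONAL only on the two displayed arithmetic hypotheses about ONE number field (the
class number parity and the prime count of `ℚ(P, i)`, resp. `K(P, i)`) — which are per-field certificates, not facts from print.
Closes nothing at the `∀`-level (C1″/C3″ OPEN); BSD is not proved by any of this.

WHY. k4-w1's door rows certify Iwasawa 1956's hypotheses («`2 ∤ h`, one prime above `2`») for the CUBIC point field `ℚ(P) = ℚ(β)`
and then need the DOWNSTAIRS Lim fact `hLim2` at a carrier with REAL places (D-audit RC-457 pending). cruxlead-19573-w2's KERNEL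
door (p718233) `PointFieldMu.exists_fineSelmerDualData_moduleFinite_of_classicalMu_pointField_adjoin` asks instead for `μ₂ = 0`
along the cyclotomic `ℤ₂`-extensions of the totally complex SEXTIC `F = K̄^{Stab P} ⊔ K⟮i⟯`, and Iwasawa 1956 (tree theorem
`iwasawa1956_classNumberPExp_eq_zero_of_not_dvd_classNumber_of_unique_prime_holds`, ANY `ℤ₂`-extension) supplies that from the
same two hypotheses AT `F`. This file is the composition:

* `classicalMuVanishes_two_of_odd_classNumber_of_unique_prime'` — Iwasawa 1956 at `p = 2` for any number field, `Nat.card` form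
  (k4-w1's `classicalMuVanishes_two_of_odd_classNumber_of_unique_prime` restated OUTSIDE the route-file cone, same 3-line proof).
* **`conjA_two_of_odd_classNumber_of_unique_prime_pointField_adjoin`** — ANY number field `K`, `W/K` elliptic, `P ∈ W[2] ∖ 0`,
  `i² = −1`: if `F = K̄^{Stab P} ⊔ K⟮i⟯` has odd class number and exactly one prime above `2`, then for every cyclotomic
  `ℤ₂`-extension of `K` some fine Selmer dual datum of `W` is finitely generated over `ℤ₂` ((A)₂ in the `∃ γ D` currency). KERNEL.
* `conjA_two_of_odd_classNumber_of_unique_prime_pointField_adjoin_rat` — the `K = ℚ` form in the route's spelling.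

The two hypotheses at `F = ℚ(β, i)` follow from the cubic data by the GENERIC Literature lemmas of this seat
(`AmbiguousClass.odd_classNumber_of_quadratic_of_nrRealPlaces_eq_one`, p722124: `h(ℚ(β))` odd, one real place, one finite prime
ramified ⟹ `h(F)` odd; `existsUnique_two_mem_of_sq_eq_neg_one` / `finprod_ramificationIdxIn_eq_two_of_sq_eq_neg_one`, p722472: one
prime above `2` in `ℚ(β)` with odd `e` ⟹ one prime above `2` in `F` and `∏ e = 2`) — the per-row instantiation (carrier
identification `ℚ̄^{Stab P} = ℚ⟮β⟯`, `nrRealPlaces ℚ(β) = 1`, `e(𝔭 | 2)`) is left to the census seats.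

References: [CoatesSujatha2005] Conj. A, Thm. 3.4; [Lim2017FineSelmer] §3 Lemma 3.2; [Greenberg2001IwasawaPastPresent] Prop. 2.1;
[Washington1997] Thm. 10.4, Prop. 13.22; [Iwasawa1973MuInvariants] §1; tree p718233 (w2 GEN 6).
-/

set_option autoImplicit false
-- sibling precedent (`…OrdKatoHalfAtTwoIsoConjATwoOfPointFieldMu.lean`): the directory name repeats the summit name
set_option linter.dupNamespace false

noncomputable section

open scoped Classical

namespace Summit.BirchSwinnertonDyer.BirchSwinnertonDyer.Theorems.AddKatoTwo

open WeierstrassCurve Field IsDedekindDomain NumberField Literature.NumberTheory.EllipticCurves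
  Literature.NumberTheory.IwasawaTheory
  Summit.BirchSwinnertonDyer.BirchSwinnertonDyer.Theorems.SteinbergFibreAtTwo
  Summit.BirchSwinnertonDyer.BirchSwinnertonDyer.Theorems.AlignedTransportAtTwoTorsionPointField

/-- **Iwasawa 1956 at `p = 2`, `Nat.card` form**: a number field `F` with `2 ∤ #Cl(𝓞 F)` and exactly one prime above `2` has
`μ₂ = 0` (growth form; indeed `e_n = 0`) along EVERY `ℤ₂`-extension — the tree's discharged fact
`iwasawa1956_classNumberPExp_eq_zero_of_not_dvd_classNumber_of_unique_prime_holds`. (Same statement as k4-w1's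
`classicalMuVanishes_two_of_odd_classNumber_of_unique_prime`, restated here outside the route-file import cone.)
[cite: Greenberg2001IwasawaPastPresent, Prop. 2.1 p. 339] [cite: Washington1997, Thm. 10.4 and Prop. 13.22] -/
theorem classicalMuVanishes_two_of_odd_classNumber_of_unique_prime' {F : Type} [Field F] [NumberField F]
    (hh : ¬ 2 ∣ Nat.card (ClassGroup (𝓞 F))) (hv : ∃! v : HeightOneSpectrum (𝓞 F), ((2 : ℕ) : 𝓞 F) ∈ v.asIdeal)
    (κ : ZpExtension F 2) : ClassicalMuVanishes κ := by
  haveI : Fact (Nat.Prime 2) := ⟨Nat.prime_two⟩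
  have hh' : ¬ 2 ∣ NumberField.classNumber F := by rwa [NumberField.classNumber, ← Nat.card_eq_fintype_card]
  exact classicalMuVanishes_of_classNumberPExp_eq_zero
    iwasawa1956_classNumberPExp_eq_zero_of_not_dvd_classNumber_of_unique_prime_holds hh' hv κ

/-- **THE SEXTIC FIELD DOOR (any number field `K`)**: `W/K` elliptic, `P ∈ W[2] ∖ 0`, `i² = −1`, `F = K̄^{Stab P} ⊔ K⟮i⟯` (for
irreducible `W[2]` over `K = ℚ` this is the sextic `ℚ(β, √−1)`, `β` the `x`-coordinate of `P`). If `2 ∤ #Cl(𝓞 F)` and `F` has exactly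
ONE prime above `2`, then statement (A) holds at `(W, 2)`: for every cyclotomic `ℤ₂`-extension `κ` of `K` some fine Selmer dual datum
of `W` over `K_∞` is finitely generated over `ℤ₂`. KERNEL composition of Iwasawa 1956 (at `F`, every `ℤ₂`-extension) with w2's door
`PointFieldMu.exists_fineSelmerDualData_moduleFinite_of_classicalMu_pointField_adjoin` (unipotent dévissage over the totally complex
`F`; no Lim 2017 fact, no ascent). [cite: CoatesSujatha2005, Conj. A and Thm. 3.4] [cite: Lim2017FineSelmer, §3 Lemma 3.2]
[cite: Greenberg2001IwasawaPastPresent, Prop. 2.1 p. 339] -/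
theorem conjA_two_of_odd_classNumber_of_unique_prime_pointField_adjoin {K : Type} [Field K] [NumberField K]
    (W : WeierstrassCurve K) [W.IsElliptic] {P : geomTorsion W 2} (hP : P ≠ 0) {i : AlgebraicClosure K} (hi : i ^ 2 = -1)
    (hh : ¬ 2 ∣ Nat.card (ClassGroup (𝓞 ↥(IntermediateField.fixedField (MulAction.stabilizer (absoluteGaloisGroup K) P) ⊔
        IntermediateField.adjoin K ({i} : Set (AlgebraicClosure K))))))
    (hv : ∃! v : HeightOneSpectrum (𝓞 ↥(IntermediateField.fixedField (MulAction.stabilizer (absoluteGaloisGroup K) P) ⊔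
        IntermediateField.adjoin K ({i} : Set (AlgebraicClosure K)))),
      ((2 : ℕ) : 𝓞 ↥(IntermediateField.fixedField (MulAction.stabilizer (absoluteGaloisGroup K) P) ⊔
        IntermediateField.adjoin K ({i} : Set (AlgebraicClosure K)))) ∈ v.asIdeal)
    (κ : ZpExtension K 2) (hκ : κ.IsCyclotomic) :
    ∃ (γ : absoluteGaloisGroup K) (D : W.FineSelmerDualData κ γ),
      Module.Finite ℤ_[2] (RestrictScalars ℤ_[2] (IwasawaAlgebra 2) D.X) := by
  haveI : Fact (Nat.Prime 2) := ⟨Nat.prime_two⟩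
  -- `F` is a number field
  have hint : IsIntegral K i := by
    refine ⟨Polynomial.X ^ 2 + 1, Polynomial.monic_X_pow_add_C _ two_ne_zero, ?_⟩
    simp [hi]
  haveI := IntermediateField.adjoin.finiteDimensional hint
  haveI := finiteDimensional_fixedField_stabilizer W P
  haveI : NumberField ↥(IntermediateField.fixedField (MulAction.stabilizer (absoluteGaloisGroup K) P) ⊔
      IntermediateField.adjoin K ({i} : Set (AlgebraicClosure K))) := NumberField.of_module_finite K _
  exact PointFieldMu.exists_fineSelmerDualData_moduleFinite_of_classicalMu_pointField_adjoin W hP hi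
    (fun κF _ => classicalMuVanishes_two_of_odd_classNumber_of_unique_prime' hh hv κF) κ hκ

/-- **THE SEXTIC FIELD DOOR over `ℚ`, in the route's spelling** (`W/ℚ` elliptic, `P ∈ W[2] ∖ 0`, `i² = −1`, `F = ℚ̄^{Stab P} ⊔ ℚ⟮i⟯`):
`2 ∤ #Cl(𝓞 F)` and one prime above `2` in `F` ⟹ `∀ κ` cyclotomic, `∃ γ D`, `D.X` finitely generated over `ℤ₂` — (A)₂ at `W` with NO
Lim 2017 fact and NO Ferrero–Washington: the replacement, on the sextic carrier, of k4-w1's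
`fineSelmerDual_moduleFinite_two_of_unique_prime_pointField hLim2` (cubic carrier). [cite: CoatesSujatha2005, Conj. A and Thm. 3.4]
[cite: Greenberg2001IwasawaPastPresent, Prop. 2.1 p. 339] -/
theorem conjA_two_of_odd_classNumber_of_unique_prime_pointField_adjoin_rat
    (W : WeierstrassCurve ℚ) [W.IsElliptic] {P : geomTorsion W 2} (hP : P ≠ 0) {i : AlgebraicClosure ℚ} (hi : i ^ 2 = -1)
    (hh : ¬ 2 ∣ Nat.card (ClassGroup (𝓞 ↥(IntermediateField.fixedField (MulAction.stabilizer (absoluteGaloisGroup ℚ) P) ⊔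
        IntermediateField.adjoin ℚ ({i} : Set (AlgebraicClosure ℚ))))))
    (hv : ∃! v : HeightOneSpectrum (𝓞 ↥(IntermediateField.fixedField (MulAction.stabilizer (absoluteGaloisGroup ℚ) P) ⊔
        IntermediateField.adjoin ℚ ({i} : Set (AlgebraicClosure ℚ)))),
      ((2 : ℕ) : 𝓞 ↥(IntermediateField.fixedField (MulAction.stabilizer (absoluteGaloisGroup ℚ) P) ⊔
        IntermediateField.adjoin ℚ ({i} : Set (AlgebraicClosure ℚ)))) ∈ v.asIdeal) :
    ∀ (κ : ZpExtension ℚ 2), κ.IsCyclotomic →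
      ∃ (γ : absoluteGaloisGroup ℚ) (D : W.FineSelmerDualData κ γ),
        Module.Finite ℤ_[2] (RestrictScalars ℤ_[2] (IwasawaAlgebra 2) D.X) :=
  fun κ hκ => conjA_two_of_odd_classNumber_of_unique_prime_pointField_adjoin W hP hi hh hv κ hκ

end Summit.BirchSwinnertonDyer.BirchSwinnertonDyer.Theorems.AddKatoTwo

end
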